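import Mathlib
import Summits.Ventures.DiscreteObjects.MOLS.PairArrayRigidity

/-!
# The array of an orthogonal pair of Latin squares has strength 2

Cell `pub-namedobj`, family SOLS. Framing: lottery ticket; floor = certified bounds/negative ranges.
Links the square vocabulary (`IsLatin`, `Orthogonal` of `CyclicQuasigroupMOLS`) to the array
vocabulary (`IsOA2` of `PairArrayRigidity`): on a finite carrier, the set of rows
`(x, y, A x y, B x y)` of two orthogonal Latin squares is a strength-2 array on `Fin 4`
(`isOA2_pairArray`). Hence `arrayAut_eq_one_of_fix` applies to pairs of MOLS: an automorphism of the
pair array fixing one of the four coordinates is trivial as soon as the corresponding coordinate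
triple is rigid.
-/

namespace Summit.Ventures.DiscreteObjects.MOLS

variable {α : Type*}

/-- The row of the cell `(x, y)` in the array of the pair `(A, B)`. -/
def prow (A B : α → α → α) (x y : α) : Fin 4 → α := ![x, y, A x y, B x y]

/-- entry 0 of a row is the row index -/
@[simp] theorem prow_zero (A B : α → α → α) (x y : α) : prow A B x y 0 = x := rfl
/-- entry 1 of a row is the column index -/
@[simp] theorem prow_one (A B : α → α → α) (x y : α) : prow A B x y 1 = y := rfl
/-- entry 2 of a row is the `A`-symbol -/
@[simp] theorem prow_two (A B : α → α → α) (x y : α) : prow A B x y 2 = A x y := rfl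
/-- entry 3 of a row is the `B`-symbol -/
@[simp] theorem prow_three (A B : α → α → α) (x y : α) : prow A B x y 3 = B x y := rfl

/-- The array (set of rows) of the pair `(A, B)`. -/
def pairArray (A B : α → α → α) : Set (Fin 4 → α) := Set.range (fun p : α × α => prow A B p.1 p.2)

/-- membership in the pair array: the rows are exactly the `prow A B x y` -/
theorem mem_pairArray {A B : α → α → α} {t : Fin 4 → α} :
    t ∈ pairArray A B ↔ ∃ x y, t = prow A B x y := by
  constructor
  · rintro ⟨⟨x, y⟩, rfl⟩; exact ⟨x, y, rfl⟩
  · rintro ⟨x, y, rfl⟩; exact ⟨(x, y), rfl⟩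

/-- A row of the pair array is determined by its first two entries. -/
theorem prow_eq_of_01 {A B : α → α → α} {x y x' y' : α} (h0 : x = x') (h1 : y = y') :
    prow A B x y = prow A B x' y' := by subst h0; subst h1; rfl

section finite

variable [Finite α] {A B : α → α → α}

/-- In a Latin square on a finite carrier every symbol occurs in every row. -/
theorem row_surjective (hA : IsLatin A) (x : α) : Function.Surjective (A x) :=
  Finite.surjective_of_injective (fun y y' h => hA.1 x y y' h)

/-- … and in every column. -/
theorem col_surjective (hA : IsLatin A) (y : α) : Function.Surjective (fun x => A x y) :=
  Finite.surjective_of_injective (fun x x' h => hA.2 y x x' h)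

/-- For orthogonal squares on a finite carrier every pair of symbols occurs in some cell. -/
theorem pair_surjective (hAB : Orthogonal A B) :
    Function.Surjective (fun p : α × α => (A p.1 p.2, B p.1 p.2)) := by
  apply Finite.surjective_of_injective
  rintro ⟨x, y⟩ ⟨x', y'⟩ h
  simp only [Prod.mk.injEq] at h
  obtain ⟨hx, hy⟩ := hAB x y x' y' h.1 h.2
  simp [hx, hy]

/-- **The pair array of two orthogonal Latin squares on a finite carrier has strength 2.** -/
theorem isOA2_pairArray (hA : IsLatin A) (hB : IsLatin B) (hAB : Orthogonal A B) :
    IsOA2 (pairArray A B) := by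
  intro i j hij a b
  -- produce the cell (x, y) whose row has entries a, b in positions i, j, and show uniqueness
  fin_cases i <;> fin_cases j
  all_goals (first | exact absurd rfl hij | skip)
  -- (0,1)
  · refine ⟨prow A B a b, ⟨⟨(a, b), rfl⟩, rfl, rfl⟩, ?_⟩
    rintro t ⟨ht, h0, h1⟩; obtain ⟨x, y, rfl⟩ := mem_pairArray.1 ht
    simp only [prow] at h0 h1; exact prow_eq_of_01 h0 h1
  -- (0,2): row a, symbol b of A
  · obtain ⟨y, hy⟩ := row_surjective hA a b
    refine ⟨prow A B a y, ⟨⟨(a, y), rfl⟩, rfl, hy⟩, ?_⟩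
    rintro t ⟨ht, h0, h2⟩; obtain ⟨x, y', rfl⟩ := mem_pairArray.1 ht
    simp only [prow] at h0 h2
    subst h0; exact prow_eq_of_01 rfl (hA.1 x y' y (h2.trans hy.symm))
  -- (0,3)
  · obtain ⟨y, hy⟩ := row_surjective hB a b
    refine ⟨prow A B a y, ⟨⟨(a, y), rfl⟩, rfl, hy⟩, ?_⟩
    rintro t ⟨ht, h0, h3⟩; obtain ⟨x, y', rfl⟩ := mem_pairArray.1 ht
    simp only [prow] at h0 h3
    subst h0; exact prow_eq_of_01 rfl (hB.1 x y' y (h3.trans hy.symm))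
  -- (1,0)
  · refine ⟨prow A B b a, ⟨⟨(b, a), rfl⟩, rfl, rfl⟩, ?_⟩
    rintro t ⟨ht, h1, h0⟩; obtain ⟨x, y, rfl⟩ := mem_pairArray.1 ht
    simp only [prow] at h0 h1; exact prow_eq_of_01 h0 h1
  -- (1,2): column a, symbol b of A
  · obtain ⟨x, hx⟩ := col_surjective hA a b
    refine ⟨prow A B x a, ⟨⟨(x, a), rfl⟩, rfl, hx⟩, ?_⟩
    rintro t ⟨ht, h1, h2⟩; obtain ⟨x', y, rfl⟩ := mem_pairArray.1 ht
    simp only [prow] at h1 h2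
    subst h1; exact prow_eq_of_01 (hA.2 y x' x (h2.trans hx.symm)) rfl
  -- (1,3)
  · obtain ⟨x, hx⟩ := col_surjective hB a b
    refine ⟨prow A B x a, ⟨⟨(x, a), rfl⟩, rfl, hx⟩, ?_⟩
    rintro t ⟨ht, h1, h3⟩; obtain ⟨x', y, rfl⟩ := mem_pairArray.1 ht
    simp only [prow] at h1 h3
    subst h1; exact prow_eq_of_01 (hB.2 y x' x (h3.trans hx.symm)) rfl
  -- (2,0)
  · obtain ⟨y, hy⟩ := row_surjective hA b a
    refine ⟨prow A B b y, ⟨⟨(b, y), rfl⟩, hy, rfl⟩, ?_⟩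
    rintro t ⟨ht, h2, h0⟩; obtain ⟨x, y', rfl⟩ := mem_pairArray.1 ht
    simp only [prow] at h0 h2
    subst h0; exact prow_eq_of_01 rfl (hA.1 x y' y (h2.trans hy.symm))
  -- (2,1)
  · obtain ⟨x, hx⟩ := col_surjective hA b a
    refine ⟨prow A B x b, ⟨⟨(x, b), rfl⟩, hx, rfl⟩, ?_⟩
    rintro t ⟨ht, h2, h1⟩; obtain ⟨x', y, rfl⟩ := mem_pairArray.1 ht
    simp only [prow] at h1 h2
    subst h1; exact prow_eq_of_01 (hA.2 y x' x (h2.trans hx.symm)) rfl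
  -- (2,3): orthogonality
  · obtain ⟨⟨x, y⟩, hxy⟩ := pair_surjective hAB (a, b)
    simp only [Prod.mk.injEq] at hxy
    refine ⟨prow A B x y, ⟨⟨(x, y), rfl⟩, hxy.1, hxy.2⟩, ?_⟩
    rintro t ⟨ht, h2, h3⟩; obtain ⟨x', y', rfl⟩ := mem_pairArray.1 ht
    simp only [prow] at h2 h3
    obtain ⟨hx, hy⟩ := hAB x' y' x y (h2.trans hxy.1.symm) (h3.trans hxy.2.symm)
    exact prow_eq_of_01 hx hy
  -- (3,0)
  · obtain ⟨y, hy⟩ := row_surjective hB b a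
    refine ⟨prow A B b y, ⟨⟨(b, y), rfl⟩, hy, rfl⟩, ?_⟩
    rintro t ⟨ht, h3, h0⟩; obtain ⟨x, y', rfl⟩ := mem_pairArray.1 ht
    simp only [prow] at h0 h3
    subst h0; exact prow_eq_of_01 rfl (hB.1 x y' y (h3.trans hy.symm))
  -- (3,1)
  · obtain ⟨x, hx⟩ := col_surjective hB b a
    refine ⟨prow A B x b, ⟨⟨(x, b), rfl⟩, hx, rfl⟩, ?_⟩
    rintro t ⟨ht, h3, h1⟩; obtain ⟨x', y, rfl⟩ := mem_pairArray.1 ht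
    simp only [prow] at h1 h3
    subst h1; exact prow_eq_of_01 (hB.2 y x' x (h3.trans hx.symm)) rfl
  -- (3,2)
  · obtain ⟨⟨x, y⟩, hxy⟩ := pair_surjective hAB (b, a)
    simp only [Prod.mk.injEq] at hxy
    refine ⟨prow A B x y, ⟨⟨(x, y), rfl⟩, hxy.2, hxy.1⟩, ?_⟩
    rintro t ⟨ht, h3, h2⟩; obtain ⟨x', y', rfl⟩ := mem_pairArray.1 ht
    simp only [prow] at h2 h3
    obtain ⟨hx, hy⟩ := hAB x' y' x y (h2.trans hxy.1.symm) (h3.trans hxy.2.symm)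
    exact prow_eq_of_01 hx hy

end finite

end Summit.Ventures.DiscreteObjects.MOLS
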